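import Mathlib
import Literature.NumberTheory.Automorphic.ReciprocityGLn
import Summits.Langlands.Langlands.Theorems.ParityBlindBianchiTwoAdicBianchiProModularityLevelStubNormTraceDet
import HarnessLib

/-!
# Stub `stub_congrDictionary` for the line `Sketch` of the crux
# `TwoAdicBianchiProModularityLevel` (stmt-Langlands-15110)

The rank-two dictionary between the crux's residual hypothesis and Hansen's normalisation of the
Hecke data.  Let `ι : ℚ̄₂ ≃ ℂ`, `q` a natural number with `‖q‖ = 1` in `ℚ̄₂`, `M ∈ M₂(ℚ̄₂)` of
finite order, `α = {x, y}` a multiset of two complex numbers with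
`charpoly M ≡ arithFrobPolyOfSatake ι q 2 α = (X - u)(X - w)` coefficientwise modulo the maximal
ideal, where `u = ι⁻¹((√q x)⁻¹)`, `w = ι⁻¹((√q y)⁻¹)`; let `a₁ = tr M / det M`, `q a₂ = 1 / det M`
(read off the identity `X² - (tr M/det M) X + 1/det M = X² - a₁ X + q a₂`), `ι b₁ = √q e₁(α)`,
`ι b₂ = e₂(α)`.  Then `‖b₁ - a₁‖ < 1` and `‖b₂ - a₂‖ < 1`.

Proof.  Put `t = tr M`, `d = det M` (`‖t‖ ≤ 1`, `‖d‖ = 1`: `stub_normTraceDet`), `u' = ι⁻¹(√q x)`,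
`w' = ι⁻¹(√q y)`, `P = u' w'`.  Comparing coefficients, `‖u'⁻¹ + w'⁻¹ - t‖ < 1`, `‖d - P⁻¹‖ < 1`,
`b₁ = u' + w'`, `q b₂ = P` (as `√q · √q = q`).  The isosceles principle gives `‖P‖ = 1`, so
`‖(u' + w') - t P‖ < 1` and `‖P - d⁻¹‖ < 1`; hence
`b₁ - a₁ = ((u' + w') - t P) + t (P - d⁻¹)` has norm `< 1`, and `q (b₂ - a₂) = P - d⁻¹` with
`‖q‖ = 1`.
-/

noncomputable section

set_option linter.dupNamespace false -- mandated namespace `Summit.Langlands.Langlands` (D-0017)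

open Polynomial Literature.NumberTheory.Automorphic

namespace Summit.Langlands.Langlands.Theorems.TwoAdicBianchiProModularityLevel

/-! ### Ultrametric core -/

/-- **The ultrametric core of the dictionary.**  In an ultrametric normed field let `‖t‖ ≤ 1`,
`‖d‖ = 1`, `‖q‖ = 1`, `‖u⁻¹ + w⁻¹ - t‖ < 1`, `‖d - u⁻¹ w⁻¹‖ < 1`, `a₁ = t d⁻¹`, `q a₂ = d⁻¹`,
`b₁ = u + w`, `q b₂ = u w`.  Then `‖b₁ - a₁‖ < 1` and `‖b₂ - a₂‖ < 1`. [folklore] -/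
theorem norm_sub_lt_one_of_congr {L : Type*} [NormedField L] [IsUltrametricDist L]
    {t d q u w a₁ a₂ b₁ b₂ : L} (ht : ‖t‖ ≤ 1) (hd : ‖d‖ = 1) (hq : ‖q‖ = 1)
    (h1 : ‖u⁻¹ + w⁻¹ - t‖ < 1) (h0 : ‖d - u⁻¹ * w⁻¹‖ < 1)
    (ha₁ : a₁ = t * d⁻¹) (ha₂ : q * a₂ = d⁻¹) (hb₁ : b₁ = u + w) (hb₂ : q * b₂ = u * w) :
    ‖b₁ - a₁‖ < 1 ∧ ‖b₂ - a₂‖ < 1 := by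
  -- the product `P = u w` is a unit
  set P := u * w with hP
  rw [← mul_inv] at h0
  have hPinv : ‖P⁻¹‖ = 1 := by
    have h := IsUltrametricDist.norm_eq_of_add_norm_lt_max (x := d) (y := -P⁻¹)
      (by rw [← sub_eq_add_neg, norm_neg]; exact lt_max_of_lt_left (h0.trans_le hd.ge))
    rw [norm_neg] at h
    rw [← h, hd]
  have hPn : ‖P‖ = 1 := by rwa [norm_inv, inv_eq_one] at hPinv
  have hP0 : P ≠ 0 := norm_ne_zero_iff.mp (by rw [hPn]; exact one_ne_zero)
  have hu : u ≠ 0 := fun h => hP0 (by rw [hP, h, zero_mul])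
  have hw : w ≠ 0 := fun h => hP0 (by rw [hP, h, mul_zero])
  have hd0 : d ≠ 0 := norm_ne_zero_iff.mp (by rw [hd]; exact one_ne_zero)
  -- the two congruences, cleared of denominators
  have k1 : ‖(u + w) - t * P‖ < 1 := by
    have e : (u + w) - t * P = (u⁻¹ + w⁻¹ - t) * P := by
      rw [hP]
      field_simp
      ring
    rw [e, norm_mul, hPn, mul_one]
    exact h1
  have k0 : ‖P - d⁻¹‖ < 1 := by
    have e : P - d⁻¹ = (d - P⁻¹) * (d⁻¹ * P) := by
      field_simp
    rw [e, norm_mul, norm_mul, norm_inv, hd, hPn, inv_one, mul_one, mul_one]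
    exact h0
  refine ⟨?_, ?_⟩
  · have e : b₁ - a₁ = ((u + w) - t * P) + t * (P - d⁻¹) := by
      rw [hb₁, ha₁]
      ring
    rw [e]
    refine (IsUltrametricDist.norm_add_le_max _ _).trans_lt (max_lt k1 ?_)
    rw [norm_mul]
    calc ‖t‖ * ‖P - d⁻¹‖ ≤ 1 * ‖P - d⁻¹‖ := by gcongr
      _ < 1 := by rw [one_mul]; exact k0
  · have e : q * (b₂ - a₂) = P - d⁻¹ := by rw [mul_sub, hb₂, ha₂]
    have h := congrArg norm e
    rw [norm_mul, hq, one_mul] at h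
    rw [h]
    exact k0

/-! ### Bookkeeping in degree two -/

/-- The `X`-coefficient and the constant coefficient of `X² - a X + b` are `-a` and `b`.
[folklore] -/
private theorem coeff_quadratic {F : Type*} [CommRing F] (a b : F) :
    (X ^ 2 - C a * X + C b : F[X]).coeff 1 = -a ∧ (X ^ 2 - C a * X + C b : F[X]).coeff 0 = b := by
  constructor <;> simp [coeff_X_pow, coeff_C]

/-- For `α = {x, y}` and `s = √q`: `s · e₁(α) = s x + s y` and `q · e₂(α) = (s x) (s y)` (as
`s · s = q`). [folklore] -/
private theorem sqrt_mul_esymm_pair (q : ℕ) (x y : ℂ) :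
    ((Real.sqrt q : ℝ) : ℂ) * ({x, y} : Multiset ℂ).esymm 1 =
        ((Real.sqrt q : ℝ) : ℂ) * x + ((Real.sqrt q : ℝ) : ℂ) * y ∧
      (q : ℂ) * ({x, y} : Multiset ℂ).esymm 2 =
        ((Real.sqrt q : ℝ) : ℂ) * x * (((Real.sqrt q : ℝ) : ℂ) * y) := by
  have hq : ((Real.sqrt q : ℝ) : ℂ) * ((Real.sqrt q : ℝ) : ℂ) = (q : ℂ) := by
    rw [← Complex.ofReal_mul, Real.mul_self_sqrt (Nat.cast_nonneg q), Complex.ofReal_natCast]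
  have e1 : ({x, y} : Multiset ℂ).esymm 1 = x + y := by
    simp [Multiset.esymm, Multiset.powersetCard_one, Multiset.insert_eq_cons]
    ring
  have e2 : ({x, y} : Multiset ℂ).esymm 2 = x * y := by
    simp [Multiset.esymm, Multiset.powersetCard_one, Multiset.insert_eq_cons,
      Multiset.powersetCard_cons]
  rw [e1, e2, ← hq]
  constructor <;> ring

/-- `arithFrobPolyOfSatake ι q 2 {x, y} = X² - (u + w) X + u w` with `u = (ι⁻¹(√q x))⁻¹`,
`w = (ι⁻¹(√q y))⁻¹`. [folklore] -/
theorem arithFrobPolyOfSatake_two_pair {ℓ : ℕ} [Fact ℓ.Prime] (ι : PadicAlgCl ℓ ≃+* ℂ) (q : ℕ)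
    (x y : ℂ) :
    arithFrobPolyOfSatake ι q 2 ({x, y} : Multiset ℂ) =
      X ^ 2 -
          C ((ι.symm (((Real.sqrt q : ℝ) : ℂ) * x))⁻¹ + (ι.symm (((Real.sqrt q : ℝ) : ℂ) * y))⁻¹) *
            X +
        C ((ι.symm (((Real.sqrt q : ℝ) : ℂ) * x))⁻¹ * (ι.symm (((Real.sqrt q : ℝ) : ℂ) * y))⁻¹) :=
    by
  have h : arithFrobPolyOfSatake ι q 2 ({x, y} : Multiset ℂ) =
      (X - C (ι.symm (((Real.sqrt q : ℝ) : ℂ) * x))⁻¹) *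
        (X - C (ι.symm (((Real.sqrt q : ℝ) : ℂ) * y))⁻¹) := by
    simp [arithFrobPolyOfSatake, Multiset.insert_eq_cons, map_inv₀]
  rw [h, C_add, C_mul]
  ring

/-! ### The stub -/

/-- STUB (A-glue) `stub_congrDictionary` — **the Satake ↔ Hansen congruence dictionary in rank two**
(elementary `2`-adic algebra).  Let `ι : ℚ̄₂ ≃ ℂ`, `q` a natural number which is a `2`-adic unit,
`M ∈ M₂(ℚ̄₂)` of finite order (an arithmetic Frobenius `σ(Frob_v)`), `α = {α₁, α₂}` a multiset of
two complex numbers (a Satake parameter) with `charpoly M ≡ ∏_j (X − ι⁻¹((q^{1/2} α_j)⁻¹))`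
coefficientwise modulo the maximal ideal of `𝒪_{ℚ̄₂}` (`arithFrobPolyOfSatake ι q 2 α`, the crux's
residual hypothesis), `a₁, a₂ ∈ ℚ̄₂` the Hansen data of `M`, i.e.
`X² − (tr M / det M) X + 1/det M = X² − a₁ X + q a₂` (`= charpoly M⁻¹`), and
`b₁ = ι⁻¹(q^{1/2} e₁(α))`, `b₂ = ι⁻¹(e₂(α))` the Hecke eigenvalues of the classical point.  Then
`‖b₁ − a₁‖ < 1` and `‖b₂ − a₂‖ < 1` (module docstring for the proof; `stub_normTraceDet` supplies
`‖tr M‖ ≤ 1`, `‖det M‖ = 1`, and the ultrametric inequality does the rest). [folklore] -/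
theorem stub_congrDictionary : ∀ (ι : PadicAlgCl 2 ≃+* ℂ) (q : ℕ), ‖((q : ℕ) : PadicAlgCl 2)‖ = 1 →
    ∀ (M : Matrix (Fin 2) (Fin 2) (PadicAlgCl 2)) (N : ℕ), 0 < N → M ^ N = 1 →
    ∀ (α : Multiset ℂ), Multiset.card α = 2 →
    (∀ i : ℕ, ‖M.charpoly.coeff i - (arithFrobPolyOfSatake ι q 2 α).coeff i‖ < 1) →
    ∀ (a₁ a₂ b₁ b₂ : PadicAlgCl 2),
    (X ^ 2 - C (M.trace * M.det⁻¹) * X + C M.det⁻¹ : (PadicAlgCl 2)[X]) =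
      X ^ 2 - C a₁ * X + C (((q : ℕ) : PadicAlgCl 2) * a₂) →
    ι b₁ = (((Real.sqrt (q : ℝ) : ℝ) : ℂ)) * α.esymm 1 → ι b₂ = α.esymm 2 →
    ‖b₁ - a₁‖ < 1 ∧ ‖b₂ - a₂‖ < 1 := by
  intro ι q hq M N hN hMN α hα hcg a₁ a₂ b₁ b₂ hpoly hb₁ hb₂
  obtain ⟨x, y, rfl⟩ := Multiset.card_eq_two.mp hα
  obtain ⟨ht, hd⟩ := stub_normTraceDet M N hN hMN
  -- names: `u = ι⁻¹(√q x)`, `w = ι⁻¹(√q y)`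
  set u : PadicAlgCl 2 := ι.symm (((Real.sqrt (q : ℝ) : ℝ) : ℂ) * x) with hu
  set w : PadicAlgCl 2 := ι.symm (((Real.sqrt (q : ℝ) : ℝ) : ℂ) * y) with hw
  -- the residual hypothesis, coefficientwise
  have h1 := hcg 1
  have h0 := hcg 0
  rw [Matrix.charpoly_fin_two, arithFrobPolyOfSatake_two_pair, (coeff_quadratic _ _).1,
    (coeff_quadratic _ _).1, neg_sub_neg] at h1
  rw [Matrix.charpoly_fin_two, arithFrobPolyOfSatake_two_pair, (coeff_quadratic _ _).2,
    (coeff_quadratic _ _).2] at h0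
  -- Hansen's normalisation, coefficientwise
  have ha₁ : a₁ = M.trace * M.det⁻¹ := by
    have h := congrArg (fun p : (PadicAlgCl 2)[X] => p.coeff 1) hpoly
    simp only [(coeff_quadratic _ _).1, neg_inj] at h
    exact h.symm
  have ha₂ : ((q : ℕ) : PadicAlgCl 2) * a₂ = M.det⁻¹ := by
    have h := congrArg (fun p : (PadicAlgCl 2)[X] => p.coeff 0) hpoly
    simp only [(coeff_quadratic _ _).2] at h
    exact h.symm
  -- the classical eigenvalues
  obtain ⟨he₁, he₂⟩ := sqrt_mul_esymm_pair q x y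
  have hb₁' : b₁ = u + w := by
    apply ι.injective
    rw [map_add, hu, hw, RingEquiv.apply_symm_apply, RingEquiv.apply_symm_apply, hb₁, he₁]
  have hb₂' : ((q : ℕ) : PadicAlgCl 2) * b₂ = u * w := by
    apply ι.injective
    rw [map_mul, map_mul, map_natCast, hu, hw, RingEquiv.apply_symm_apply,
      RingEquiv.apply_symm_apply, hb₂, he₂]
  exact norm_sub_lt_one_of_congr ht hd hq h1 h0 ha₁ ha₂ hb₁' hb₂'

end Summit.Langlands.Langlands.Theorems.TwoAdicBianchiProModularityLevel

end
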